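import Mathlib
import Literature.Computation.Certificates.LinearODETaylorJets
import Literature.Analysis.ODE.LinearSecondOrder
import HarnessLib

/-!
# Kernel-checkable analytic continuation of linear second-order ODEs, II: the stage certificate

Topic `Literature/Computation/Certificates` (namespace `Literature.Computation.Certificates.LinearODE`). The data of one
continuation stage and its Boolean checker, with the analytic consequences of acceptance:
* `Equation` (`P₂, P₁, P₀ : List ℚ`), `Equation.pH/qH/IsSolOn` (the solved form `y″ = 𝔭 y′ + 𝔮 y`, `𝔭 = −P₁/P₂`,
  `𝔮 = −P₀/P₂`, phrased as in `LinearSecondOrder.eqOn_of_solution_Ioo`); `Stage` ⟨`h`, preconditioner `U`, `ρ`, `μ`, `N`⟩;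
* `mulL` (products, for the PRECONDITIONED pair `N·U / D·U` — same quotient, margin up to near the true radius
  [cite: Henrici1974, §2.3 Lemma 2.3f]); `DL/N1L/N0L` (the normalised, shifted, preconditioned coefficient lists);
  `thetaQ`, `numSumQ` (the denominator margin and numerator sums of `ratTaylor_of_natDegree_le`), `KQ`, `bmaxQ`
  (the jet constant `B`), `psumQ`;
* `Equation.stageCheck` — THE CHECKER: `P₂(c) ≠ 0`, `(U·D)₀ = 1`, `0 < ρ`, `θ < 1`, `1/ρ < μ`, `1 ≤ N`, `|h| < ρ`,
  `μ|h| < 1`, `2K + 1 ≤ N (μ − 1/ρ)`; `ptL/qtL/jetL`, `StageOut/stageOut` (columns `S¹, S²` and tails `τ₁, τ₂`);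
* `isOrdinaryPointData_of_check` — acceptance puts the centre's data in `IsOrdinaryPointData` (with `P₂(c+x) ≠ 0` on the
  disc) [cite: CoddingtonLevinson1955, Ch. 3 §8]; `norm_ordCoeff_le_of_check` — the jet bound `‖vₙ(e)‖ ≤ B μⁿ` for
  both basis columns [cite: CoddingtonLevinson1955, Ch. 4 §3].
Soundness of the stage (`stage_sound`) and of chains are in parts III–IV. No axioms beyond the standard three, no `sorry`.

## References
* P. Henrici, *Applied and Computational Complex Analysis*, Vol. 1, Wiley 1974: §1.2 (formal power series, the division
  recursion (1.2-2)), §2.3 Lemma 2.3f (majorant of the reciprocal), §3.6 (numerical analytic continuation along an arc,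
  eqs. (3.6-10)–(3.6-13)). Key `Henrici1974`.
* E. A. Coddington, N. Levinson, *Theory of Ordinary Differential Equations*, McGraw–Hill 1955, Ch. 3 §8 (linear
  equations with analytic coefficients), Ch. 4 §3 (the majorant method). Key `CoddingtonLevinson1955`.
* P. Hartman, *Ordinary Differential Equations*, SIAM Classics 38 (2002), Ch. IV §1 Lemma 1.1 (uniqueness), §12 (12.12)
  (undetermined coefficients). Key `Hartman2002`.
* R. E. Moore, *Interval Analysis*, Prentice–Hall 1966, §3.2 (rounded rational arithmetic). Key `Moore1966`.
-/

open Finset Polynomial Set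
open Literature.Analysis.ODE

namespace Literature.Computation.Certificates

namespace LinearODE

/-! ### Polynomial products on coefficient lists (for the preconditioner) -/

/-- Coefficient `n` of the product of two coefficient lists. [cite: Henrici1974, §1.2 eq. (1.2-2)] -/
def mulCoeff (a b : List ℚ) (n : ℕ) : ℚ := sumR (fun i => a.getD i 0 * b.getD (n - i) 0) (n + 1)

/-- The product of two coefficient lists (length `|a| + |b|`). [cite: Henrici1974, §1.2 eq. (1.2-2)] -/
def mulL (a b : List ℚ) : List ℚ := (List.range (a.length + b.length)).map (mulCoeff a b)

/-- `toPolyR (a · b) = toPolyR a · toPolyR b`. [cite: Henrici1974, §1.2 eq. (1.2-2)] -/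
theorem toPolyR_mulL (a b : List ℚ) : toPolyR (mulL a b) = toPolyR a * toPolyR b := by
  ext n
  rw [coeff_toPolyR, coeff_mul, Finset.Nat.sum_antidiagonal_eq_sum_range_succ_mk]
  simp only [coeff_toPolyR]
  by_cases hn : n < a.length + b.length
  · rw [mulL, List.getD_eq_getElem _ _ (by simpa using hn)]
    simp only [List.getElem_map, List.getElem_range]
    rw [mulCoeff, sumR_eq]
    push_cast
    rfl
  · rw [mulL, List.getD_eq_default _ _ (by simpa using hn)]
    push_cast
    symm
    refine Finset.sum_eq_zero fun i hi => ?_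
    have hi' := mem_range.1 hi
    by_cases ha : i < a.length
    · rw [List.getD_eq_default b _ (by omega)]; simp
    · rw [List.getD_eq_default a _ (by omega)]; simp

/-! ### The equation, the stage data, and the checker -/

/-- A linear second-order equation `P₂(u) y″ + P₁(u) y′ + P₀(u) y = 0` with rational polynomial coefficients
(coefficient lists, index = degree). [cite: CoddingtonLevinson1955, Ch. 3 §8] -/
structure Equation where
  /-- leading coefficient `P₂` -/
  P2 : List ℚ
  /-- coefficient `P₁` of `y′` -/
  P1 : List ℚ
  /-- coefficient `P₀` of `y` -/
  P0 : List ℚ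

/-- One analytic-continuation stage: signed step `h`, preconditioner `U` (a polynomial with `U₀ = 1`, e.g. a truncated
inverse of `D = P₂(c+x)/P₂(c)`, or `[1]`), majorant radius `ρ`, rate `μ > 1/ρ`, jet length `N`.
[cite: Henrici1974, §3.6 eqs. (3.6-10)–(3.6-13)] -/
structure Stage where
  /-- the signed step `h` (next centre `c + h`) -/
  h : ℚ
  /-- preconditioner `U` (`[1]` for none) -/
  U : List ℚ
  /-- the radius `ρ` of the Cauchy majorant of the (preconditioned) coefficient data at the centre -/
  rho : ℚ
  /-- the geometric rate `μ > 1/ρ` claimed for the solution's Taylor coefficients -/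
  mu : ℚ
  /-- the jet length `N ≥ 1` (Taylor polynomial of degree `N − 1`, remainder from order `N`) -/
  N : ℕ

namespace Equation

variable (E : Equation)

/-- The coefficient `𝔭 = −P₁/P₂` of `y′` in the solved form `y″ = 𝔭 y′ + 𝔮 y`. [cite: CoddingtonLevinson1955, Ch. 3 §8] -/
noncomputable def pH (u : ℝ) : ℝ := -((toPolyR E.P1).eval u / (toPolyR E.P2).eval u)

/-- The coefficient `𝔮 = −P₀/P₂` of `y` in the solved form `y″ = 𝔭 y′ + 𝔮 y`. [cite: CoddingtonLevinson1955, Ch. 3 §8] -/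
noncomputable def qH (u : ℝ) : ℝ := -((toPolyR E.P0).eval u / (toPolyR E.P2).eval u)

/-- `(y, y′)` solves the equation on `s`: `y′` is the derivative of `y` and `y″ = 𝔭 y′ + 𝔮 y` pointwise on `s` (the
phrasing of `LinearSecondOrder.eqOn_of_solution_Ioo`). [cite: Hartman2002, Ch. IV Lemma 1.1] -/
def IsSolOn (y y' : ℝ → ℝ) (s : Set ℝ) : Prop :=
  ∀ u ∈ s, HasDerivAt y (y' u) u ∧ HasDerivAt y' (E.pH u * y' u + E.qH u * y u) u

/-- `d = P₂(c)`. [cite: Henrici1974, §3.6 eq. (3.6-10)] -/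
def dQ (c : ℚ) : ℚ := evalQ E.P2 c

/-- The preconditioned denominator `D = U · P₂(c + x)/P₂(c)`. [cite: Henrici1974, §2.3 Lemma 2.3f] -/
def DL (c : ℚ) (U : List ℚ) : List ℚ := mulL ((taylorQ E.P2 c).map (· / E.dQ c)) U
/-- The preconditioned numerator `N₁ = U · P₁(c + x)/P₂(c)`. [cite: Henrici1974, §2.3 Lemma 2.3f] -/
def N1L (c : ℚ) (U : List ℚ) : List ℚ := mulL ((taylorQ E.P1 c).map (· / E.dQ c)) U
/-- The preconditioned numerator `N₀ = U · P₀(c + x)/P₂(c)`. [cite: Henrici1974, §2.3 Lemma 2.3f] -/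
def N0L (c : ℚ) (U : List ℚ) : List ℚ := mulL ((taylorQ E.P0 c).map (· / E.dQ c)) U

end Equation

/-- The denominator margin `θ = Σ_{j ≥ 1} |D_j| ρʲ` (summed over `j + 1 ≤ |D|`). [cite: Henrici1974, §2.3 Lemma 2.3f] -/
def thetaQ (D : List ℚ) (ρ : ℚ) : ℚ := sumR (fun j => |D.getD (j + 1) 0| * ρ ^ (j + 1)) D.length

/-- The numerator sum `S = Σ_i |P_i| ρⁱ`. [cite: Henrici1974, §2.3 Lemma 2.3f] -/
def numSumQ (P : List ℚ) (ρ : ℚ) : ℚ := sumR (fun i => |P.getD i 0| * ρ ^ i) (P.length + 1)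

/-- `max_{n ≤ m} max(|v_n,1|, |v_n,2|) μ⁻ⁿ` over a jet list: the constant `B` of the jet bound `‖vₙ‖ ≤ B μⁿ`.
[cite: CoddingtonLevinson1955, Ch. 4 §3] -/
def bmaxQ (vs : List (ℚ × ℚ)) (μ : ℚ) : ℕ → ℚ
  | 0 => max |(vs.getD 0 0).1| |(vs.getD 0 0).2|
  | m + 1 => max (bmaxQ vs μ m) (max |(vs.getD (m + 1) 0).1| |(vs.getD (m + 1) 0).2| / μ ^ (m + 1))

/-- The partial sums `Σ_{n<N} hⁿ v_n` (both components). [cite: Henrici1974, §3.6 eq. (3.6-11)] -/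
def psumQ (vs : List (ℚ × ℚ)) (h : ℚ) (N : ℕ) : ℚ × ℚ :=
  (sumR (fun n => h ^ n * (vs.getD n 0).1) N, sumR (fun n => h ^ n * (vs.getD n 0).2) N)

namespace Equation

variable (E : Equation)

/-- The coefficient bound `K = max(S₁, S₀)/(1 − θ)` at the centre. [cite: Henrici1974, §2.3 Lemma 2.3f] -/
def KQ (c : ℚ) (st : Stage) : ℚ :=
  max (numSumQ (E.N1L c st.U) st.rho) (numSumQ (E.N0L c st.U) st.rho) / (1 - thetaQ (E.DL c st.U) st.rho)

/-- **THE STAGE CHECKER** (exact rational comparisons only): `P₂(c) ≠ 0`, `(U·D)₀ = 1`, `0 < ρ`, `θ < 1`,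
`1/ρ < μ`, `N ≥ 1`, `|h| < ρ`, `μ|h| < 1`, and the jet threshold `2K + 1 ≤ N (μ − 1/ρ)`.
[cite: CoddingtonLevinson1955, Ch. 4 §3] [cite: Henrici1974, §3.6 eqs. (3.6-10)–(3.6-13)] -/
def stageCheck (c : ℚ) (st : Stage) : Bool :=
  decide (E.dQ c ≠ 0) && decide ((E.DL c st.U).getD 0 0 = 1) && decide (0 < st.rho) &&
    decide (thetaQ (E.DL c st.U) st.rho < 1) && decide (st.rho⁻¹ < st.mu) && decide (1 ≤ st.N) &&
    decide (|st.h| < st.rho) && decide (st.mu * |st.h| < 1) &&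
    decide (2 * E.KQ c st + 1 ≤ st.N * (st.mu - st.rho⁻¹))

/-- The coefficient list `[P̃₀, …, P̃_{N−1}]` of `P₁/P₂` at the centre. [cite: Henrici1974, §1.2 eq. (1.2-2)] -/
def ptL (c : ℚ) (st : Stage) : List ℚ := divCoeffs (E.N1L c st.U) (E.DL c st.U) st.N
/-- The coefficient list `[Q̃₀, …, Q̃_{N−1}]` of `P₀/P₂` at the centre. [cite: Henrici1974, §1.2 eq. (1.2-2)] -/
def qtL (c : ℚ) (st : Stage) : List ℚ := divCoeffs (E.N0L c st.U) (E.DL c st.U) st.N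

/-- The jet (orders `0 … N−1`) of the basis solution through `e`. [cite: Hartman2002, Ch. IV §12 (12.12)] -/
def jetL (c : ℚ) (st : Stage) (e : ℚ × ℚ) : List (ℚ × ℚ) := jets (E.ptL c st) (E.qtL c st) e (st.N - 1)

/-- The output of a stage: the columns `S¹`, `S²` (partial sums of `(y, y′)(c+h)` from `(1,0)` and `(0,1)`) and the tail
bounds `τ₁`, `τ₂` (`τᵢ = Bᵢ (μ|h|)^N/(1 − μ|h|)`). [cite: Henrici1974, §3.6 eqs. (3.6-11)–(3.6-13)] -/
structure StageOut where
  /-- partial sum of `(y, y′)(c + h)` from `(y, y′)(c) = (1, 0)` -/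
  S1 : ℚ × ℚ
  /-- partial sum of `(y, y′)(c + h)` from `(y, y′)(c) = (0, 1)` -/
  S2 : ℚ × ℚ
  /-- tail bound of column 1 -/
  τ1 : ℚ
  /-- tail bound of column 2 -/
  τ2 : ℚ

/-- **THE STAGE COMPUTATION** (exact rational arithmetic). [cite: Henrici1974, §3.6 eqs. (3.6-10)–(3.6-13)] -/
def stageOut (c : ℚ) (st : Stage) : StageOut :=
  let v1 := E.jetL c st (1, 0)
  let v2 := E.jetL c st (0, 1)
  let t := (st.mu * |st.h|) ^ st.N / (1 - st.mu * |st.h|)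
  ⟨psumQ v1 st.h st.N, psumQ v2 st.h st.N, bmaxQ v1 st.mu (st.N - 1) * t, bmaxQ v2 st.mu (st.N - 1) * t⟩

end Equation

/-! ### Cast lemmas for the margins, the jet bound and the partial sums -/

/-- The margin sum, cast. [cite: Henrici1974, §2.3 Lemma 2.3f] -/
theorem cast_thetaQ (D : List ℚ) (ρ : ℚ) :
    ((thetaQ D ρ : ℚ) : ℝ) = ∑ j ∈ range D.length, ‖(toPolyR D).coeff (j + 1)‖ * (ρ : ℝ) ^ (j + 1) := by
  rw [thetaQ, sumR_eq (α := ℚ)]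
  push_cast
  refine Finset.sum_congr rfl fun j _ => ?_
  rw [coeff_toPolyR, Real.norm_eq_abs]

/-- The numerator sum, cast. [cite: Henrici1974, §2.3 Lemma 2.3f] -/
theorem cast_numSumQ (P : List ℚ) (ρ : ℚ) :
    ((numSumQ P ρ : ℚ) : ℝ) = ∑ i ∈ range (P.length + 1), ‖(toPolyR P).coeff i‖ * (ρ : ℝ) ^ i := by
  rw [numSumQ, sumR_eq (α := ℚ)]
  push_cast
  refine Finset.sum_congr rfl fun j _ => ?_
  rw [coeff_toPolyR, Real.norm_eq_abs]

/-- `0 ≤ S`. [cite: Henrici1974, §2.3 Lemma 2.3f] -/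
theorem numSumQ_nonneg (P : List ℚ) {ρ : ℚ} (hρ : 0 ≤ ρ) : 0 ≤ numSumQ P ρ := by
  have h : (0 : ℝ) ≤ ((numSumQ P ρ : ℚ) : ℝ) := by
    rw [cast_numSumQ]
    exact Finset.sum_nonneg fun i _ => by positivity
  exact_mod_cast h

/-- `max(|v_n,1|, |v_n,2|) ≤ B μⁿ` for every entry of the jet list up to `m` (`B = bmaxQ`).
[cite: CoddingtonLevinson1955, Ch. 4 §3] -/
theorem le_bmaxQ (vs : List (ℚ × ℚ)) {μ : ℚ} (hμ : 0 < μ) :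
    ∀ (m n : ℕ), n ≤ m → max |(vs.getD n 0).1| |(vs.getD n 0).2| ≤ bmaxQ vs μ m * μ ^ n
  | 0, n, hn => by
    obtain rfl : n = 0 := Nat.le_zero.1 hn
    simp [bmaxQ]
  | m + 1, n, hn => by
    have hμn : 0 < μ ^ n := pow_pos hμ n
    rcases Nat.lt_succ_iff_lt_or_eq.1 (Nat.lt_succ_iff.2 hn) with hlt | rfl
    · calc max |(vs.getD n 0).1| |(vs.getD n 0).2| ≤ bmaxQ vs μ m * μ ^ n :=
          le_bmaxQ vs hμ m n (Nat.lt_succ_iff.1 hlt)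
        _ ≤ bmaxQ vs μ (m + 1) * μ ^ n := mul_le_mul_of_nonneg_right (le_max_left _ _) hμn.le
    · rw [bmaxQ]
      calc max |(vs.getD (m + 1) 0).1| |(vs.getD (m + 1) 0).2|
          = max |(vs.getD (m + 1) 0).1| |(vs.getD (m + 1) 0).2| / μ ^ (m + 1) * μ ^ (m + 1) := by
            rw [div_mul_cancel₀ _ (pow_pos hμ _).ne']
        _ ≤ _ := mul_le_mul_of_nonneg_right (le_max_right _ _) (pow_pos hμ _).le

/-- `0 ≤ B`. [cite: CoddingtonLevinson1955, Ch. 4 §3] -/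
theorem bmaxQ_nonneg (vs : List (ℚ × ℚ)) {μ : ℚ} (hμ : 0 < μ) (m : ℕ) : 0 ≤ bmaxQ vs μ m :=
  le_trans (le_trans (abs_nonneg _) (le_max_left _ _)) (by simpa using le_bmaxQ vs hμ m 0 (Nat.zero_le m))

/-- The cast partial sum is the partial sum of the series `Σ hⁿ • vₙ`. [cite: Henrici1974, §3.6 eq. (3.6-11)] -/
theorem castPair_psumQ {vs : List (ℚ × ℚ)} {V : ℕ → ℝ × ℝ} {N : ℕ} (hv : ∀ n < N, castPair (vs.getD n 0) = V n)
    (h : ℚ) : castPair (psumQ vs h N) = ∑ n ∈ range N, (h : ℝ) ^ n • V n := by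
  ext
  · simp only [castPair_fst, psumQ]
    rw [sumR_eq (α := ℚ), Prod.fst_sum]
    push_cast
    refine Finset.sum_congr rfl fun n hn => ?_
    rw [Prod.smul_fst, smul_eq_mul, ← hv n (mem_range.1 hn), castPair_fst]
  · simp only [castPair_snd, psumQ]
    rw [sumR_eq (α := ℚ), Prod.snd_sum]
    push_cast
    refine Finset.sum_congr rfl fun n hn => ?_
    rw [Prod.smul_snd, smul_eq_mul, ← hv n (mem_range.1 hn), castPair_snd]

namespace Equation

variable (E : Equation)

/-! ### The analytic data at a checked centre -/

/-- What the preconditioned lists are, as real polynomials: `D = d⁻¹ · P₂(c + ·) · U` etc.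
[cite: Henrici1974, §2.3 Lemma 2.3f] -/
theorem eval_DL (c : ℚ) (U : List ℚ) (x : ℝ) :
    (toPolyR (E.DL c U)).eval x = ((E.dQ c : ℚ) : ℝ)⁻¹ * (toPolyR E.P2).eval (x + c) * (toPolyR U).eval x ∧
    (toPolyR (E.N1L c U)).eval x = ((E.dQ c : ℚ) : ℝ)⁻¹ * (toPolyR E.P1).eval (x + c) * (toPolyR U).eval x ∧
    (toPolyR (E.N0L c U)).eval x = ((E.dQ c : ℚ) : ℝ)⁻¹ * (toPolyR E.P0).eval (x + c) * (toPolyR U).eval x := by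
  refine ⟨?_, ?_, ?_⟩ <;>
  · simp only [DL, N1L, N0L, toPolyR_mulL, toPolyR_map_div, toPolyR_taylorQ, eval_mul, eval_C, taylor_eval]

/-- **THE STEP AT A CHECKED CENTRE (analytic form).** If `stageCheck c st = true`, then with `d = P₂(c)`,
`a = 1/ρ`, `K = KQ`, the Taylor coefficient sequences `pt = ratTaylorCoeff N₁ D`, `qt = ratTaylorCoeff N₀ D` and the
functions `P̃(x) = P₁(c+x)/P₂(c+x)`, `Q̃(x) = P₀(c+x)/P₂(c+x)` form `IsOrdinaryPointData pt qt P̃ Q̃ a K ρ`, and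
`P₂(c + x) ≠ 0` on `‖x‖ < ρ`. [cite: CoddingtonLevinson1955, Ch. 3 §8 and Ch. 4 §3] [cite: Henrici1974, §2.3 Lemma 2.3f] -/
theorem isOrdinaryPointData_of_check {c : ℚ} {st : Stage} (hc : E.stageCheck c st = true) :
    IsOrdinaryPointData (𝕜 := ℝ)
      (fun k => ratTaylorCoeff (toPolyR (E.N1L c st.U)) (toPolyR (E.DL c st.U)) k)
      (fun k => ratTaylorCoeff (toPolyR (E.N0L c st.U)) (toPolyR (E.DL c st.U)) k)
      (fun x => (toPolyR E.P1).eval (x + c) / (toPolyR E.P2).eval (x + c))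
      (fun x => (toPolyR E.P0).eval (x + c) / (toPolyR E.P2).eval (x + c))
      ((st.rho : ℝ)⁻¹) (E.KQ c st) st.rho ∧
    ∀ x : ℝ, ‖x‖ < st.rho → (toPolyR E.P2).eval (x + c) ≠ 0 := by
  simp only [stageCheck, Bool.and_eq_true, decide_eq_true_eq] at hc
  obtain ⟨⟨⟨⟨⟨⟨⟨⟨hd, hD0⟩, hρ⟩, hθ⟩, -⟩, -⟩, -⟩, -⟩, -⟩ := hc
  set D := E.DL c st.U
  set N1 := E.N1L c st.U
  set N0 := E.N0L c st.U
  have hρR : (0 : ℝ) < st.rho := by exact_mod_cast hρ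
  have hQ0 : (toPolyR D).coeff 0 = 1 := by rw [coeff_toPolyR, hD0]; push_cast; rfl
  have hθR : ((thetaQ D st.rho : ℚ) : ℝ) < 1 := by exact_mod_cast hθ
  have hDQ : (toPolyR D).natDegree ≤ D.length := (natDegree_toPolyR_le D).trans (Nat.sub_le _ _)
  have hθle : ∑ j ∈ range D.length, ‖(toPolyR D).coeff (j + 1)‖ * (st.rho : ℝ) ^ (j + 1) ≤
      ((thetaQ D st.rho : ℚ) : ℝ) := (cast_thetaQ D st.rho).symm.le
  have hmain : ∀ P : List ℚ,
      (∀ n, ‖ratTaylorCoeff (toPolyR P) (toPolyR D) n‖ ≤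
          ((numSumQ P st.rho : ℚ) : ℝ) / (1 - ((thetaQ D st.rho : ℚ) : ℝ)) * (st.rho : ℝ)⁻¹ ^ n) ∧
        ∀ x : ℝ, ‖x‖ < st.rho → (toPolyR D).eval x ≠ 0 ∧
          HasSum (fun n => x ^ n * ratTaylorCoeff (toPolyR P) (toPolyR D) n)
            ((toPolyR P).eval x / (toPolyR D).eval x) := fun P =>
    ratTaylor_of_natDegree_le (toPolyR P) (toPolyR D) hQ0 hρR hDQ
      ((natDegree_toPolyR_le P).trans (Nat.sub_le _ _)) hθle hθR (cast_numSumQ P st.rho).symm.le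
  have h1 := hmain N1
  have h0 := hmain N0
  -- the constant `K`
  have h1θ : (0 : ℝ) < 1 - ((thetaQ D st.rho : ℚ) : ℝ) := by linarith
  have hKcast : ((E.KQ c st : ℚ) : ℝ) =
      max ((numSumQ N1 st.rho : ℚ) : ℝ) ((numSumQ N0 st.rho : ℚ) : ℝ) / (1 - ((thetaQ D st.rho : ℚ) : ℝ)) := by
    rw [KQ]; push_cast; rfl
  have hK1 : ((numSumQ N1 st.rho : ℚ) : ℝ) / (1 - ((thetaQ D st.rho : ℚ) : ℝ)) ≤ E.KQ c st := by
    rw [hKcast]; exact div_le_div_of_nonneg_right (le_max_left _ _) h1θ.le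
  have hK0 : ((numSumQ N0 st.rho : ℚ) : ℝ) / (1 - ((thetaQ D st.rho : ℚ) : ℝ)) ≤ E.KQ c st := by
    rw [hKcast]; exact div_le_div_of_nonneg_right (le_max_right _ _) h1θ.le
  have hKnn : (0 : ℝ) ≤ E.KQ c st := le_trans
    (div_nonneg (by exact_mod_cast numSumQ_nonneg N1 hρ.le) h1θ.le) hK1
  -- evaluation of the preconditioned quotient
  have hdR : ((E.dQ c : ℚ) : ℝ) ≠ 0 := by exact_mod_cast hd
  have hquot : ∀ x : ℝ, ‖x‖ < st.rho → (toPolyR E.P2).eval (x + c) ≠ 0 ∧ (toPolyR st.U).eval x ≠ 0 ∧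
      (toPolyR N1).eval x / (toPolyR D).eval x = (toPolyR E.P1).eval (x + c) / (toPolyR E.P2).eval (x + c) ∧
      (toPolyR N0).eval x / (toPolyR D).eval x = (toPolyR E.P0).eval (x + c) / (toPolyR E.P2).eval (x + c) := by
    intro x hx
    have hDx := (h1.2 x hx).1
    obtain ⟨eD, eN1, eN0⟩ := E.eval_DL c st.U x
    rw [eD] at hDx
    have hP2 : (toPolyR E.P2).eval (x + c) ≠ 0 := by
      intro h; apply hDx; rw [h]; ring
    have hU : (toPolyR st.U).eval x ≠ 0 := by
      intro h; apply hDx; rw [h]; ring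
    refine ⟨hP2, hU, ?_, ?_⟩
    · rw [eN1, eD, mul_div_mul_right _ _ hU, mul_div_mul_left _ _ (inv_ne_zero hdR)]
    · rw [eN0, eD, mul_div_mul_right _ _ hU, mul_div_mul_left _ _ (inv_ne_zero hdR)]
  refine ⟨⟨inv_pos.2 hρR, hKnn, hρR, fun k => ?_, fun k => ?_, fun x hx => ?_, fun x hx => ?_⟩,
    fun x hx => (hquot x hx).1⟩
  · exact (h1.1 k).trans (mul_le_mul_of_nonneg_right hK1 (pow_nonneg (inv_pos.2 hρR).le k))
  · exact (h0.1 k).trans (mul_le_mul_of_nonneg_right hK0 (pow_nonneg (inv_pos.2 hρR).le k))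
  · rw [← (hquot x hx).2.2.1]; exact (h1.2 x hx).2
  · rw [← (hquot x hx).2.2.2]; exact (h0.2 x hx).2

/-- The jet bound for a basis column from the checker: `‖vₙ(e)‖ ≤ B μⁿ` for all `n`, `B = bmaxQ`.
[cite: CoddingtonLevinson1955, Ch. 4 §3] -/
theorem norm_ordCoeff_le_of_check {c : ℚ} {st : Stage} (hc : E.stageCheck c st = true) (e : ℚ × ℚ) (n : ℕ) :
    ‖ordCoeff (fun k => ratTaylorCoeff (toPolyR (E.N1L c st.U)) (toPolyR (E.DL c st.U)) k)
        (fun k => ratTaylorCoeff (toPolyR (E.N0L c st.U)) (toPolyR (E.DL c st.U)) k) (e.1 : ℝ) (e.2 : ℝ) n‖ ≤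
      ((bmaxQ (E.jetL c st e) st.mu (st.N - 1) : ℚ) : ℝ) * (st.mu : ℝ) ^ n := by
  have hdata := (E.isOrdinaryPointData_of_check hc).1
  simp only [stageCheck, Bool.and_eq_true, decide_eq_true_eq] at hc
  obtain ⟨⟨⟨⟨⟨⟨⟨⟨-, -⟩, hρ⟩, -⟩, hμ⟩, hN⟩, -⟩, -⟩, hthr⟩ := hc
  have hμ0 : 0 < st.mu := lt_trans (inv_pos.2 hρ) hμ
  -- the computed jet is the Taylor jet
  have hjet : ∀ m ≤ st.N - 1, castPair ((E.jetL c st e).getD m 0) =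
      ordCoeff (fun k => ratTaylorCoeff (toPolyR (E.N1L c st.U)) (toPolyR (E.DL c st.U)) k)
        (fun k => ratTaylorCoeff (toPolyR (E.N0L c st.U)) (toPolyR (E.DL c st.U)) k) (e.1 : ℝ) (e.2 : ℝ) m := by
    intro m hm
    have h := cast_jets (pt := E.ptL c st) (qt := E.qtL c st) e.1 e.2 (st.N - 1)
      (fun k hk => cast_divCoeffs _ _ (by omega)) (fun k hk => cast_divCoeffs _ _ (by omega)) m hm
    simpa [jetL] using h
  set B := bmaxQ (E.jetL c st e) st.mu (st.N - 1) with hB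
  have hBnn : 0 ≤ B := bmaxQ_nonneg _ hμ0 _
  have hjetB : ∀ m < st.N, ‖ordCoeff (fun k => ratTaylorCoeff (toPolyR (E.N1L c st.U)) (toPolyR (E.DL c st.U)) k)
      (fun k => ratTaylorCoeff (toPolyR (E.N0L c st.U)) (toPolyR (E.DL c st.U)) k) (e.1 : ℝ) (e.2 : ℝ) m‖ ≤
        (B : ℝ) * (st.mu : ℝ) ^ m := by
    intro m hm
    rw [← hjet m (by omega), norm_castPair]
    exact_mod_cast le_bmaxQ (E.jetL c st e) hμ0 (st.N - 1) m (by omega)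
  refine hdata.norm_ordCoeff_le_of_jet (N := st.N) (by exact_mod_cast hμ) ?_ hjetB ?_ n
  · have h0 := hjetB 0 (by omega)
    simpa using h0
  · have hthrR : (2 * (E.KQ c st : ℝ) + 1) ≤ (st.N : ℝ) * ((st.mu : ℝ) - (st.rho : ℝ)⁻¹) := by exact_mod_cast hthr
    have hBR : (0 : ℝ) ≤ B := by exact_mod_cast hBnn
    calc (2 * (E.KQ c st : ℝ) + 1) * (B : ℝ) ≤ ((st.N : ℝ) * ((st.mu : ℝ) - (st.rho : ℝ)⁻¹)) * B :=
          mul_le_mul_of_nonneg_right hthrR hBR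
      _ = (st.N : ℝ) * (B : ℝ) * ((st.mu : ℝ) - (st.rho : ℝ)⁻¹) := by ring

end Equation

end LinearODE

end Literature.Computation.Certificates
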